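import Summits.CriticalPhenomena.PercolationContinuityZ3.Theorems.PercNearOneGluingNoHeavyLowerTailSahiUnionClosed

/-!
# Sahi's functional on a union-closed block system, III: MAX-SYSTEMS are union-closed (MAXBLOCK)

Support file of the one-cut programme (crux `NoHeavyLowerTail`, stmt-CriticalPhenomena-4575; cell `prim-masterthm`, seat P5 gen 4; report
`P5-LORENTZIAN-TEST.md` §9.3–9.4).  The block systems that appear when the minimal-multidegree Bernstein coefficients of `E_k` of a CYLINDER
family are extracted are the MAX-SYSTEMS: given labels `f` with index sets `I_f` and chosen subsets `O_f`, a block `B` is allowed iff for every `f`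
either `B` misses `I_f` or the LARGEST element of `B ∩ I_f` lies in `O_f` (report §9.4: `b_s = Σ_O T(𝒜_O)`).  Here (any linear order on the points):
* `SahiUnionClosed.maxSystem_union` — the max-system predicate is preserved under unions;
* `SahiUnionClosed.supClosed_maxSystem` — the max-system inside `2^S` is `SupClosed`;
* **`SahiUnionClosed.T_maxSystem_nonneg`** — MAXBLOCK: `T_{𝒜_O}(S) ≥ 0` for every nonempty `S` (Theorem (U), `T_nonneg`).
HONEST LABEL: the identity linking these sums to `sahiE` of cylinder families is verified exactly in the report (check_bridge.py) but NOT formalised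
here; the tree's proof of (M⁺⁺) for cylinders is `…SahiCombCylinderMinDegree` (a different route). [this work]
-/

open scoped Classical

namespace Summit.CriticalPhenomena.PercolationContinuityZ3.Theorems

namespace SahiUnionClosed

open Finset

variable {ι : Type*} [LinearOrder ι] {κ : Type*}

/-- The max-system predicate: for every label `f`, the block `B` misses `I f` or the largest element of `B ∩ I f` belongs to `O f`
(stated without `Finset.max'`: some element of `B ∩ I f ∩ O f` dominates `B ∩ I f`). [this work] -/
theorem maxSystem_union (I O : κ → Finset ι) {B B' : Finset ι}
    (hB : ∀ f, (∀ x ∈ B, x ∉ I f) ∨ ∃ m ∈ B, m ∈ I f ∧ m ∈ O f ∧ ∀ x ∈ B, x ∈ I f → x ≤ m)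
    (hB' : ∀ f, (∀ x ∈ B', x ∉ I f) ∨ ∃ m ∈ B', m ∈ I f ∧ m ∈ O f ∧ ∀ x ∈ B', x ∈ I f → x ≤ m) :
    ∀ f, (∀ x ∈ B ∪ B', x ∉ I f) ∨ ∃ m ∈ B ∪ B', m ∈ I f ∧ m ∈ O f ∧ ∀ x ∈ B ∪ B', x ∈ I f → x ≤ m := by
  intro f
  rcases hB f with h1 | ⟨m, hmB, hmI, hmO, hmax⟩ <;> rcases hB' f with h2 | ⟨m', hm'B, hm'I, hm'O, hmax'⟩
  · exact Or.inl fun x hx => (mem_union.1 hx).elim (h1 x) (h2 x)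
  · refine Or.inr ⟨m', mem_union_right _ hm'B, hm'I, hm'O, fun x hx hxI => ?_⟩
    rcases mem_union.1 hx with hx' | hx'
    · exact absurd hxI (h1 x hx')
    · exact hmax' x hx' hxI
  · refine Or.inr ⟨m, mem_union_left _ hmB, hmI, hmO, fun x hx hxI => ?_⟩
    rcases mem_union.1 hx with hx' | hx'
    · exact hmax x hx' hxI
    · exact absurd hxI (h2 x hx')
  · by_cases hmm : m ≤ m'
    · refine Or.inr ⟨m', mem_union_right _ hm'B, hm'I, hm'O, fun x hx hxI => ?_⟩
      rcases mem_union.1 hx with hx' | hx'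
      · exact (hmax x hx' hxI).trans hmm
      · exact hmax' x hx' hxI
    · refine Or.inr ⟨m, mem_union_left _ hmB, hmI, hmO, fun x hx hxI => ?_⟩
      rcases mem_union.1 hx with hx' | hx'
      · exact hmax x hx' hxI
      · exact (hmax' x hx' hxI).trans (le_of_not_ge hmm)

/-- **Max-systems are union-closed**: inside `2^S`, the blocks satisfying the max-system predicate form a `SupClosed` family. [this work] -/
theorem supClosed_maxSystem (S : Finset ι) (I O : κ → Finset ι) :
    SupClosed (↑(S.powerset.filter fun B => ∀ f, (∀ x ∈ B, x ∉ I f) ∨ ∃ m ∈ B, m ∈ I f ∧ m ∈ O f ∧ ∀ x ∈ B, x ∈ I f → x ≤ m) :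
      Set (Finset ι)) := by
  intro B hB B' hB'
  rw [Finset.coe_filter, Set.mem_setOf_eq] at hB hB' ⊢
  refine ⟨mem_powerset.2 (union_subset (mem_powerset.1 hB.1) (mem_powerset.1 hB'.1)), ?_⟩
  rw [sup_eq_union]
  exact maxSystem_union I O hB.2 hB'.2

/-- **MAXBLOCK** (report §9.4): Sahi's functional of every max-system is nonnegative,
`Σ_{π ∈ Part(S), every block B of π with (B ∩ I_f = ∅ ∨ max(B ∩ I_f) ∈ O_f) ∀ f} (−1)^{|π|−1} ∏ (|B|−1)! ≥ 0`. [this work] -/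
theorem T_maxSystem_nonneg {S : Finset ι} (hS : S.Nonempty) (I O : κ → Finset ι) :
    0 ≤ T (S.powerset.filter fun B => ∀ f, (∀ x ∈ B, x ∉ I f) ∨ ∃ m ∈ B, m ∈ I f ∧ m ∈ O f ∧ ∀ x ∈ B, x ∈ I f → x ≤ m) S :=
  T_nonneg (supClosed_maxSystem S I O) hS

end SahiUnionClosed

end Summit.CriticalPhenomena.PercolationContinuityZ3.Theorems
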